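import Summits.AtomisticToContinuum.FouriersLaw.Theorems.OddSectorIrreversibilityConeScaleCorrectorStubDynkinLeftEnergy
import Summits.AtomisticToContinuum.FouriersLaw.Theorems.OddSectorIrreversibilityConeScaleCorrectorStubGeneratorLeftEnergy
import Summits.AtomisticToContinuum.FouriersLaw.Theorems.OddSectorIrreversibilityConeScaleCorrectorStubCentredCorrector
import Summits.AtomisticToContinuum.FouriersLaw.Theorems.BoundaryEscapeDeficitBoundaryKernelBasics

/-!
# `ConeScaleCorrector` (E1), line `gamblers-ruin-defect`: stub `stub_correctorSplitting`

Registered stub of crux stmt-AtomisticToContinuum-14069 (fixed `N ≥ 2`): the exact one-contact splitting of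
the Kubo corrector, `u = (N−1)·(W + E_L − μ_T(E_L)/Z)` `μ_T`-a.e., where `E_L = H − X/(N−1)`
(`X = energyMoment`), and `W` is the (everywhere) limit of the finite-horizon forecasts `∫₀^τ P_t w_L dt` of the
left bath power `w_L = γ(T − p₀²)`.

Proof (all inputs are proved tree facts): the generator identity `L E_L = w_L − J/(N−1)`
(`stub_generatorLeftEnergy`), Dynkin's identity for `E_L` under the constructed kernels (`stub_dynkinLeftEnergy`):
`P_r E_L(z) − E_L(z) = W_r(z) − u_r(z)/(N−1)`; as `r → ∞`, `P_r E_L(z) → π(E_L)` (Harris bound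
`pinnedChain_harris_bound`), `W_r(z) → W⋆(z)` and `u_r(z) → u⋆(z)` at EVERY `z` (`centred_tendsto_corrector`, the
sources `w_L`, `J` being continuous, of exponential class and centred); hence
`u⋆ = (N−1)(W⋆ + E_L − π(E_L))` everywhere, and `u = u⋆` `μ_T`-a.e. by uniqueness of limits.
-/

noncomputable section

open MeasureTheory ProbabilityTheory Filter Topology Set
open scoped ENNReal NNReal BigOperators
open Literature.MathematicalPhysics.KineticTheory.HeatConduction
open Literature.Barriers.AtomisticToContinuum.OpenChain
open Summit.AtomisticToContinuum.FouriersLaw.Theorems.SubdiffusiveBondHeat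
open Summit.AtomisticToContinuum.FouriersLaw.Theorems.LightConeBondHeat

namespace Summit.AtomisticToContinuum.FouriersLaw.Theorems.OddSectorIrreversibility

variable {N : ℕ}

/-! ### The left bath power `w_L = γ(T − p₀²)` as a centred nice observable -/

/-- The sum over `i = 0` collapses: `w_L(y) = γ(T − p₀²)` for `N ≥ 1`. [folklore] -/
theorem leftBathPower_eq (γ T : ℝ) (hN : 0 < N) (y : PhaseSpace N) :
    (∑ i : Fin N, if i.val = 0 then γ * (T - y.2 i ^ 2) else 0) = γ * (T - y.2 ⟨0, hN⟩ ^ 2) := by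
  rw [Finset.sum_eq_single ⟨0, hN⟩]
  · simp
  · intro i _ hi
    rw [if_neg]
    intro h
    exact hi (Fin.ext h)
  · intro h
    exact absurd (Finset.mem_univ _) h

/-- `w_L` is continuous. [folklore] -/
theorem continuous_leftBathPower (γ T : ℝ) (hN : 0 < N) :
    Continuous fun y : PhaseSpace N => ∑ i : Fin N, if i.val = 0 then γ * (T - y.2 i ^ 2) else 0 := by
  have h : (fun y : PhaseSpace N => ∑ i : Fin N, if i.val = 0 then γ * (T - y.2 i ^ 2) else 0) =
      fun y => γ * (T - y.2 ⟨0, hN⟩ ^ 2) := funext fun y => leftBathPower_eq γ T hN y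
  rw [h]
  fun_prop

/-- `w_L` is of exponential class: `|w_L| ≤ γ(2/ϑ + T) e^{ϑH}` (`γ, T ≥ 0`, `ϑ > 0`). [folklore] -/
theorem abs_leftBathPower_le_exp {ω₂ lam β : ℝ} (hω : 0 < ω₂) (hl : 0 ≤ lam) (hβ : 0 ≤ β) {γ T : ℝ}
    (hγ : 0 ≤ γ) (hT : 0 ≤ T) (hN : 0 < N) {ϑ : ℝ} (hϑ : 0 < ϑ) (y : PhaseSpace N) :
    |∑ i : Fin N, (if i.val = 0 then γ * (T - y.2 i ^ 2) else 0)| ≤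
      γ * (2 / ϑ + T) * Real.exp (ϑ * (pinnedChain ω₂ lam β γ).hamiltonian N y) := by
  rw [leftBathPower_eq γ T hN y, abs_mul, abs_of_nonneg hγ, mul_assoc]
  refine mul_le_mul_of_nonneg_left ?_ hγ
  rw [abs_sub_comm]
  exact abs_sq_momentum_sub_le_exp hω hl hβ hϑ hT y ⟨0, hN⟩

/-- `w_L` is centred: `∫ w_L dμ_T = 0` (equipartition `∫ p₀² dμ_T = T`). [folklore] -/
theorem integral_leftBathPower_gibbsMeasure {ω₂ lam β : ℝ} (hω : 0 < ω₂) (hl : 0 ≤ lam) (hβ : 0 ≤ β)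
    (γ : ℝ) {T : ℝ} (hT : 0 < T) (hN : 0 < N) :
    ∫ y, (∑ i : Fin N, (if i.val = 0 then γ * (T - y.2 i ^ 2) else 0))
      ∂((pinnedChain ω₂ lam β γ).gibbsMeasure N T) = 0 := by
  simp_rw [leftBathPower_eq γ T hN]
  have h := pinnedChain_integral_kinObs_gibbsMeasure hω hl hβ γ N hT ⟨0, hN⟩
  have e : (fun y : PhaseSpace N => γ * (T - y.2 ⟨0, hN⟩ ^ 2)) =
      fun y => (-γ) * (y.2 ⟨0, hN⟩ ^ 2 - T) := funext fun y => by ring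
  rw [e, integral_const_mul, h, mul_zero]

/-! ### The splitting at the level of the everywhere-defined correctors -/

section Core

variable {ω₂ lam β γ : ℝ} (hω : 0 < ω₂) (hl : 0 < lam) (hβ : 0 < β) (hγ : 0 < γ) {T : ℝ} (hT : 0 < T)
  (hN : 2 ≤ N)

set_option hygiene false in
/-- the chain -/
local notation "Pc" => pinnedChain ω₂ lam β γ
set_option hygiene false in
/-- the equilibrium kernels at real time `t` (clamped) -/
local notation "κ[" t "]" => (pinnedChain ω₂ lam β γ).transitionKernel N T T (Real.toNNReal t)
set_option hygiene false in
/-- the total current -/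
local notation "J[" y "]" => ∑ i : Fin N, (pinnedChain ω₂ lam β γ).bondCurrent N i y
set_option hygiene false in
/-- the left bath power -/
local notation "w[" y "]" => ∑ i : Fin N, (if (i : Fin N).val = 0 then γ * (T - (y : PhaseSpace N).2 i ^ 2) else 0)
set_option hygiene false in
/-- the left-exit-weighted energy `E_L = H − X/(N−1)` -/
local notation "e[" y "]" =>
  (pinnedChain ω₂ lam β γ).hamiltonian N y - energyMoment (pinnedChain ω₂ lam β γ) N y / ((N : ℝ) - 1)

include hω hl hβ hγ hT hN

/-- **The pointwise splitting identity.** With `u⋆ = ∫_{(0,∞)} P_tJ dt`, `W⋆ = ∫_{(0,∞)} P_t w_L dt` (both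
defined EVERYWHERE) and `E_L = H − X/(N−1)`: `u⋆(z) = (N−1)(W⋆(z) + E_L(z) − π(E_L))` for every `z`
(`π = gibbsMeasure`). [folklore] -/
theorem corrector_eq_leftSplitting (z : PhaseSpace N) :
    (∫ t in Ioi (0 : ℝ), ∫ y, J[y] ∂(κ[t] z)) =
      ((N : ℝ) - 1) * ((∫ t in Ioi (0 : ℝ), ∫ y, w[y] ∂(κ[t] z)) +
        (e[z] - ∫ y, e[y] ∂((Pc).gibbsMeasure N T))) := by
  have hN0 : 0 < N := by omega
  have hN1 : (0 : ℝ) < (N : ℝ) - 1 := by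
    have : (2 : ℝ) ≤ N := by exact_mod_cast hN
    linarith
  -- Harris data at `ϑ = 1/(4T)`
  obtain ⟨hϑ0, h2ϑ⟩ := quarter_inv_temp_admissible hT
  have hϑ1 : 1 / (4 * T) < 1 / T := by linarith
  obtain ⟨K, c, hK, hc, hb⟩ := pinnedChain_harris_bound hω hl.le hβ hγ hN0 hT hϑ0 hϑ1
  -- J: continuous, exponential class, centred
  have hJc : Continuous fun y : PhaseSpace N => J[y] := continuous_totalBondCurrent ω₂ lam β γ N
  have hCJ : (0 : ℝ) ≤ N * (N * ((3 + β) / 2) * (2 * Real.exp (1 / (4 * T)) / (1 / (4 * T)) ^ 2)) := by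
    have := hβ.le; positivity
  have hJb : ∀ y : PhaseSpace N, |J[y]| ≤ N * (N * ((3 + β) / 2) * (2 * Real.exp (1 / (4 * T)) / (1 / (4 * T)) ^ 2)) *
      Real.exp (1 / (4 * T) * (Pc).hamiltonian N y) :=
    abs_totalBondCurrent_le_exp hω.le hl.le hβ.le γ N hϑ0
  have hJ0 : ∫ y, J[y] ∂((Pc).gibbsMeasure N T) = 0 :=
    integral_totalBondCurrent_gibbsMeasure hω hl.le hβ.le γ N hT
  -- w: continuous, exponential class, centred
  have hwc : Continuous fun y : PhaseSpace N => w[y] := continuous_leftBathPower γ T hN0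
  have hCw : (0 : ℝ) ≤ γ * (2 / (1 / (4 * T)) + T) := by have := hγ.le; positivity
  have hwb : ∀ y : PhaseSpace N, |w[y]| ≤ γ * (2 / (1 / (4 * T)) + T) *
      Real.exp (1 / (4 * T) * (Pc).hamiltonian N y) :=
    abs_leftBathPower_le_exp hω hl.le hβ.le hγ.le hT.le hN0 hϑ0
  have hw0 : ∫ y, w[y] ∂((Pc).gibbsMeasure N T) = 0 :=
    integral_leftBathPower_gibbsMeasure hω hl.le hβ.le γ hT hN0
  -- e: continuous, exponential class
  have heC : Continuous fun y : PhaseSpace N => e[y] := by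
    have h1 : Continuous ((Pc).hamiltonian N) := pinnedChain_continuous_hamiltonian ω₂ lam β γ N
    have h2 : Continuous (energyMoment (Pc) N) :=
      (contDiff_energyMoment_of_contDiff (Pc) (N := N) (pinnedChain_contDiff_U ω₂ lam β γ (n := 0))
        (pinnedChain_contDiff_V ω₂ lam β γ (n := 0))).continuous
    exact h1.sub (h2.div_const _)
  have hCe : (0 : ℝ) ≤ 1 / (1 / (4 * T)) := by positivity
  have heb : ∀ y : PhaseSpace N, |e[y]| ≤ 1 / (1 / (4 * T)) * Real.exp (1 / (4 * T) * (Pc).hamiltonian N y) := by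
    intro y
    obtain ⟨h0, h1⟩ := pinnedChain_leftEnergy_nonneg_le hω.le hl.le hβ.le γ hN y
    rw [abs_of_nonneg h0]
    refine h1.trans ?_
    have hx : 1 / (4 * T) * (Pc).hamiltonian N y + 1 ≤
        Real.exp (1 / (4 * T) * (Pc).hamiltonian N y) := Real.add_one_le_exp _
    rw [div_mul_eq_mul_div, one_mul, le_div_iff₀ hϑ0]
    nlinarith
  -- pointwise convergence of the finite-horizon correctors of J and w, at `z`
  have hJt : Tendsto (fun τ : ℝ => ∫ t in Ioc (0 : ℝ) τ, ∫ y, J[y] ∂(κ[t] z)) atTop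
      (𝓝 (∫ t in Ioi (0 : ℝ), ∫ y, J[y] ∂(κ[t] z))) :=
    centred_tendsto_corrector hK.le hb hc hJc hCJ hJb hJ0 hω hl.le hβ.le hγ.le z
  have hwt : Tendsto (fun τ : ℝ => ∫ t in Ioc (0 : ℝ) τ, ∫ y, w[y] ∂(κ[t] z)) atTop
      (𝓝 (∫ t in Ioi (0 : ℝ), ∫ y, w[y] ∂(κ[t] z))) :=
    centred_tendsto_corrector hK.le hb hc hwc hCw hwb hw0 hω hl.le hβ.le hγ.le z
  -- convergence of `P_r e(z)` to `π(e)`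
  have het : Tendsto (fun r : ℝ => ∫ y, e[y] ∂(κ[r] z)) atTop (𝓝 (∫ y, e[y] ∂((Pc).gibbsMeasure N T))) := by
    have hbound : ∀ r : ℝ, 0 ≤ r →
        |(∫ y, e[y] ∂(κ[r] z)) - ∫ y, e[y] ∂((Pc).gibbsMeasure N T)| ≤
          (K * (1 / (1 / (4 * T))) * Real.exp (1 / (4 * T) * (Pc).hamiltonian N z)) * Real.exp (-(c * r)) := by
      intro r hr
      have h := hb z r.toNNReal (fun y => e[y]) heC _ hCe heb
      rw [Real.coe_toNNReal r hr, neg_mul] at h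
      exact h
    have hdec : Tendsto (fun r : ℝ => (K * (1 / (1 / (4 * T))) * Real.exp (1 / (4 * T) * (Pc).hamiltonian N z)) *
        Real.exp (-(c * r))) atTop (𝓝 0) := by
      have h1 : Tendsto (fun r : ℝ => c * r) atTop atTop := tendsto_id.const_mul_atTop hc
      have h2 := (Real.tendsto_exp_neg_atTop_nhds_zero.comp h1).const_mul
        (K * (1 / (1 / (4 * T))) * Real.exp (1 / (4 * T) * (Pc).hamiltonian N z))
      rw [mul_zero] at h2
      exact h2
    refine tendsto_iff_norm_sub_tendsto_zero.2
      (squeeze_zero' (Eventually.of_forall fun r => norm_nonneg _) ?_ hdec)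
    filter_upwards [eventually_ge_atTop (0 : ℝ)] with r hr
    rw [Real.norm_eq_abs]
    exact hbound r hr
  -- integrability of `w`, `J` under the kernels, and of their forecasts in time
  have hwI : ∀ s : ℝ, Integrable (fun y : PhaseSpace N => w[y]) (κ[s] z) := fun s =>
    integrable_of_abs_le_exp
      (pinnedChain_integrable_exp_mul_hamiltonian_transitionKernel hω hl.le hT hβ.le hγ.le hN0 hϑ0 hϑ1 _ z) hwc hwb
  have hJI : ∀ s : ℝ, Integrable (fun y : PhaseSpace N => J[y]) (κ[s] z) := fun s =>
    integrable_of_abs_le_exp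
      (pinnedChain_integrable_exp_mul_hamiltonian_transitionKernel hω hl.le hT hβ.le hγ.le hN0 hϑ0 hϑ1 _ z) hJc hJb
  have hwS : IntegrableOn (fun s : ℝ => ∫ y, w[y] ∂(κ[s] z)) (Ioi 0) :=
    centred_integrableOn_act hK.le hb hc hwc hCw hwb hw0 hω hl.le hβ.le hγ.le z
  have hJS : IntegrableOn (fun s : ℝ => ∫ y, J[y] ∂(κ[s] z)) (Ioi 0) :=
    centred_integrableOn_act hK.le hb hc hJc hCJ hJb hJ0 hω hl.le hβ.le hγ.le z
  -- Dynkin + generator identity at every horizon `r ≥ 0`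
  have hdyn : ∀ r : ℝ, 0 ≤ r →
      (∫ y, e[y] ∂(κ[r] z)) - e[z] =
        (∫ s in Ioc (0 : ℝ) r, ∫ y, w[y] ∂(κ[s] z)) -
          (1 / ((N : ℝ) - 1)) * ∫ s in Ioc (0 : ℝ) r, ∫ y, J[y] ∂(κ[s] z) := by
    intro r hr
    have h1 := stub_dynkinLeftEnergy ω₂ lam β γ hω hl hβ hγ T hT N hN r.toNNReal z
    rw [Real.coe_toNNReal r hr] at h1
    have h1' : (∫ y, e[y] ∂(κ[r] z)) - e[z] =
        ∫ s in (0 : ℝ)..r, ∫ y, (Pc).generator N T T (fun y' : PhaseSpace N => e[y']) y ∂(κ[s] z) := h1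
    rw [h1']
    have hgen : ∀ s : ℝ, (∫ y, (Pc).generator N T T (fun y' : PhaseSpace N => e[y']) y ∂(κ[s] z)) =
        (∫ y, w[y] ∂(κ[s] z)) - (1 / ((N : ℝ) - 1)) * ∫ y, J[y] ∂(κ[s] z) := by
      intro s
      have hfun : ∀ y : PhaseSpace N, (Pc).generator N T T (fun y' : PhaseSpace N => e[y']) y =
          w[y] - (1 / ((N : ℝ) - 1)) * J[y] :=
        fun y => stub_generatorLeftEnergy ω₂ lam β γ T N hN y
      rw [integral_congr_ae (Eventually.of_forall hfun), integral_sub (hwI s) ((hJI s).const_mul _),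
        integral_const_mul]
    rw [intervalIntegral.integral_congr (fun s _ => hgen s)]
    have hwS' : IntervalIntegrable (fun s : ℝ => ∫ y, w[y] ∂(κ[s] z)) volume 0 r :=
      (intervalIntegrable_iff_integrableOn_Ioc_of_le hr).2 (hwS.mono_set Ioc_subset_Ioi_self)
    have hJS' : IntervalIntegrable (fun s : ℝ => ∫ y, J[y] ∂(κ[s] z)) volume 0 r :=
      (intervalIntegrable_iff_integrableOn_Ioc_of_le hr).2 (hJS.mono_set Ioc_subset_Ioi_self)
    rw [intervalIntegral.integral_sub hwS' (hJS'.const_mul _), intervalIntegral.integral_const_mul,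
      intervalIntegral.integral_of_le hr, intervalIntegral.integral_of_le hr]
  -- pass to the limit `r → ∞`
  have hlim1 : Tendsto (fun r : ℝ => (∫ y, e[y] ∂(κ[r] z)) - e[z]) atTop
      (𝓝 ((∫ y, e[y] ∂((Pc).gibbsMeasure N T)) - e[z])) :=
    het.sub tendsto_const_nhds
  have hlim2 : Tendsto (fun r : ℝ => (∫ s in Ioc (0 : ℝ) r, ∫ y, w[y] ∂(κ[s] z)) -
      (1 / ((N : ℝ) - 1)) * ∫ s in Ioc (0 : ℝ) r, ∫ y, J[y] ∂(κ[s] z)) atTop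
      (𝓝 ((∫ t in Ioi (0 : ℝ), ∫ y, w[y] ∂(κ[t] z)) -
        (1 / ((N : ℝ) - 1)) * ∫ t in Ioi (0 : ℝ), ∫ y, J[y] ∂(κ[t] z))) :=
    hwt.sub (hJt.const_mul _)
  have heq : (∫ y, e[y] ∂((Pc).gibbsMeasure N T)) - e[z] =
      (∫ t in Ioi (0 : ℝ), ∫ y, w[y] ∂(κ[t] z)) -
        (1 / ((N : ℝ) - 1)) * ∫ t in Ioi (0 : ℝ), ∫ y, J[y] ∂(κ[t] z) := by
    refine tendsto_nhds_unique (hlim1.congr' ?_) hlim2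
    filter_upwards [eventually_ge_atTop (0 : ℝ)] with r hr using hdyn r hr
  -- rearrange
  have h2 : (1 / ((N : ℝ) - 1)) * (∫ t in Ioi (0 : ℝ), ∫ y, J[y] ∂(κ[t] z)) =
      (∫ t in Ioi (0 : ℝ), ∫ y, w[y] ∂(κ[t] z)) + (e[z] - ∫ y, e[y] ∂((Pc).gibbsMeasure N T)) := by
    linarith
  calc (∫ t in Ioi (0 : ℝ), ∫ y, J[y] ∂(κ[t] z))
      = ((N : ℝ) - 1) * ((1 / ((N : ℝ) - 1)) * ∫ t in Ioi (0 : ℝ), ∫ y, J[y] ∂(κ[t] z)) := by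
        field_simp
    _ = _ := by rw [h2]

/-- **The splitting, packaged on `gibbsMeasure`.** There is `W ∈ L²(π)` (the everywhere limit of the forecasts of
`w_L`) with `u⋆ = (N−1)(W + E_L − π(E_L))` everywhere. [folklore] -/
theorem exists_leftSplitting_gibbsMeasure :
    ∃ W : PhaseSpace N → ℝ,
      MemLp W 2 ((Pc).gibbsMeasure N T) ∧
      (∀ z, Tendsto (fun τ : ℝ => ∫ t in Ioc (0 : ℝ) τ, ∫ y, w[y] ∂(κ[t] z)) atTop (𝓝 (W z))) ∧
      ∀ z, (∫ t in Ioi (0 : ℝ), ∫ y, J[y] ∂(κ[t] z)) =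
        ((N : ℝ) - 1) * (W z + (e[z] - ∫ y, e[y] ∂((Pc).gibbsMeasure N T))) := by
  have hN0 : 0 < N := by omega
  obtain ⟨hϑ0, h2ϑ⟩ := quarter_inv_temp_admissible hT
  have hϑ1 : 1 / (4 * T) < 1 / T := by linarith
  obtain ⟨K, c, hK, hc, hb⟩ := pinnedChain_harris_bound hω hl.le hβ hγ hN0 hT hϑ0 hϑ1
  have hwc : Continuous fun y : PhaseSpace N => w[y] := continuous_leftBathPower γ T hN0
  have hCw : (0 : ℝ) ≤ γ * (2 / (1 / (4 * T)) + T) := by have := hγ.le; positivity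
  have hwb : ∀ y : PhaseSpace N, |w[y]| ≤ γ * (2 / (1 / (4 * T)) + T) *
      Real.exp (1 / (4 * T) * (Pc).hamiltonian N y) :=
    abs_leftBathPower_le_exp hω hl.le hβ.le hγ.le hT.le hN0 hϑ0
  have hw0 : ∫ y, w[y] ∂((Pc).gibbsMeasure N T) = 0 :=
    integral_leftBathPower_gibbsMeasure hω hl.le hβ.le γ hT hN0
  refine ⟨fun z => ∫ t in Ioi (0 : ℝ), ∫ y, w[y] ∂(κ[t] z), ?_, ?_, ?_⟩
  · exact centred_memLp_corrector hK.le hb hc hwc hCw hwb hw0 hω hl.le hβ.le hγ.le hT h2ϑ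
  · exact fun z => centred_tendsto_corrector hK.le hb hc hwc hCw hwb hw0 hω hl.le hβ.le hγ.le z
  · exact fun z => corrector_eq_leftSplitting hω hl hβ hγ hT hN z

end Core

/-! ### The registered stub -/

/-- **stub_correctorSplitting** (FIXED `N ≥ 2`): for all parameters `> 0`, `T > 0`, `N ≥ 2` and every `u`
satisfying the crux's corrector predicate (a.e.-limit of `∫₀^τ P_tJ_tot dt` under the constructed equilibrium
kernels), there is `W ∈ L²(μ_T)`, an a.e.-limit of the forecasts `∫₀^τ P_t w_L dt` of the left bath power
`w_L = γ(T − p₀²)`, with `u = (N−1)·(W + E_L − c)` `μ_T`-a.e., `E_L = H − X/(N−1)`, `c = ∫E_L dμ_T / Z`.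
Proof: `μ_T = Z • gibbsMeasure`; the correctors of `J` and of `w_L` converge EVERYWHERE (Harris bound), the
pointwise identity is `corrector_eq_leftSplitting` (generator identity `stub_generatorLeftEnergy` + Dynkin
`stub_dynkinLeftEnergy` + ergodic limit), and `u` equals the everywhere-limit a.e. by uniqueness of limits.
[folklore] -/
theorem stub_correctorSplitting :
    ∀ ω₂ lam β γ : ℝ, 0 < ω₂ → 0 < lam → 0 < β → 0 < γ → ∀ T : ℝ, 0 < T → ∀ N : ℕ, 2 ≤ N →
    ∀ u : PhaseSpace N → ℝ,
    (∀ᵐ x ∂(volume.withDensity fun x : PhaseSpace N =>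
        ENNReal.ofReal (Real.exp (-((pinnedChain ω₂ lam β γ).hamiltonian N x) / T))),
      Tendsto (fun τ : ℝ => ∫ t in Set.Ioc (0 : ℝ) τ,
          ∫ y, (∑ i : Fin N, (pinnedChain ω₂ lam β γ).bondCurrent N i y)
            ∂((pinnedChain ω₂ lam β γ).transitionKernel N T T t.toNNReal x)) atTop (𝓝 (u x))) →
    ∃ W : PhaseSpace N → ℝ,
      MemLp W 2 (volume.withDensity fun x : PhaseSpace N =>
        ENNReal.ofReal (Real.exp (-((pinnedChain ω₂ lam β γ).hamiltonian N x) / T))) ∧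
      (∀ᵐ x ∂(volume.withDensity fun x : PhaseSpace N =>
          ENNReal.ofReal (Real.exp (-((pinnedChain ω₂ lam β γ).hamiltonian N x) / T))),
        Tendsto (fun τ : ℝ => ∫ t in Set.Ioc (0 : ℝ) τ,
            ∫ y, (∑ i : Fin N, if i.val = 0 then γ * (T - y.2 i ^ 2) else 0)
              ∂((pinnedChain ω₂ lam β γ).transitionKernel N T T t.toNNReal x)) atTop (𝓝 (W x))) ∧
      (∀ᵐ x ∂(volume.withDensity fun x : PhaseSpace N =>
          ENNReal.ofReal (Real.exp (-((pinnedChain ω₂ lam β γ).hamiltonian N x) / T))),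
        u x = ((N : ℝ) - 1) * (W x +
          (((pinnedChain ω₂ lam β γ).hamiltonian N x
              - energyMoment (pinnedChain ω₂ lam β γ) N x / ((N : ℝ) - 1))
            - (∫ y, ((pinnedChain ω₂ lam β γ).hamiltonian N y
                  - energyMoment (pinnedChain ω₂ lam β γ) N y / ((N : ℝ) - 1))
                ∂(volume.withDensity fun x : PhaseSpace N =>
                    ENNReal.ofReal (Real.exp (-((pinnedChain ω₂ lam β γ).hamiltonian N x) / T))))
              / (∫ y : PhaseSpace N, Real.exp (-((pinnedChain ω₂ lam β γ).hamiltonian N y) / T))))) := by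
  intro ω₂ lam β γ hω hl hβ hγ T hT N hN u hu
  have hN0 : 0 < N := by omega
  obtain ⟨W, hWmem, hWt, hsplit⟩ := exists_leftSplitting_gibbsMeasure (N := N) hω hl hβ hγ hT hN
  -- `μ_T = Z • π`
  have hμ := withDensity_exp_neg_hamiltonian_eq_smul_gibbsMeasure hω hl.le hβ.le γ N hT
  have hint := pinnedChain_integrable_gibbsDensity hω hl.le hβ.le γ N hT
  have hZtop : (pinnedChain ω₂ lam β γ).partitionFunction N T ≠ ⊤ :=
    (pinnedChain ω₂ lam β γ).partitionFunction_ne_top hint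
  have hZ0 : (pinnedChain ω₂ lam β γ).partitionFunction N T ≠ 0 :=
    (pinnedChain ω₂ lam β γ).partitionFunction_ne_zero (pinnedChain_continuous_gibbsDensity ω₂ lam β γ N T)
  -- the everywhere-limit `u⋆` of the correctors of `J`
  obtain ⟨-, -, hJt⟩ := centredCorrector_gibbsMeasure hω hl.le hβ hγ hN0 hT (N := N)
  refine ⟨W, ?_, Eventually.of_forall hWt, ?_⟩
  · rw [hμ]; exact hWmem.smul_measure hZtop
  · -- the normalising constant: `∫ E_L dμ_T / Z = ∫ E_L dπ`
    have hZreal : ((pinnedChain ω₂ lam β γ).partitionFunction N T).toReal =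
        ∫ y : PhaseSpace N, Real.exp (-((pinnedChain ω₂ lam β γ).hamiltonian N y) / T) := by
      rw [(pinnedChain ω₂ lam β γ).partitionFunction_eq_ofReal_integral hint, ENNReal.toReal_ofReal
        (integral_nonneg fun x => ((pinnedChain ω₂ lam β γ).gibbsDensity_pos N T x).le)]
      rfl
    have hZpos : 0 < ((pinnedChain ω₂ lam β γ).partitionFunction N T).toReal :=
      ENNReal.toReal_pos hZ0 hZtop
    have hc : (∫ y, ((pinnedChain ω₂ lam β γ).hamiltonian N y -
          energyMoment (pinnedChain ω₂ lam β γ) N y / ((N : ℝ) - 1))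
          ∂(volume.withDensity fun x : PhaseSpace N =>
            ENNReal.ofReal (Real.exp (-((pinnedChain ω₂ lam β γ).hamiltonian N x) / T)))) /
          (∫ y : PhaseSpace N, Real.exp (-((pinnedChain ω₂ lam β γ).hamiltonian N y) / T)) =
        ∫ y, ((pinnedChain ω₂ lam β γ).hamiltonian N y -
          energyMoment (pinnedChain ω₂ lam β γ) N y / ((N : ℝ) - 1))
          ∂((pinnedChain ω₂ lam β γ).gibbsMeasure N T) := by
      rw [hμ, integral_smul_measure, ← hZreal, smul_eq_mul, mul_comm, mul_div_assoc, div_self hZpos.ne', mul_one]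
    rw [hc]
    -- `u = u⋆` a.e., and the pointwise identity
    filter_upwards [hu] with x hx
    rw [tendsto_nhds_unique hx (hJt x)]
    exact hsplit x

end Summit.AtomisticToContinuum.FouriersLaw.Theorems.OddSectorIrreversibility
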